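import Summits.QuantumFields.BalabanUV.T4Continuum.Support.SubstrateBackgroundTransporters
import Summits.QuantumFields.BalabanUV.T4Continuum.Support.CovariantBlockAveraging

/-!
# SUBSTRATE — the [dict] «V1 ↔ V2» for PARALLEL TRANSPORT ALONG CONTOURS and BAŁABAN's COVARIANT BLOCK AVERAGING OF A GAUGE FIELD:
# V2's `CovariantBlockAveraging.transport` of the transporters of `U` IS `ι` of the path-ordered product of the bond variables,
# `Q_k(U) := Qcov n M Γ (transV e ι U)` is the covariant k-fold averaging AS A FUNCTION OF `U` (at `U = 1` it is `Q_k ⊗ 1`), and the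
# gauge law of transport along bond PATHS (follower of `SubstrateBackgroundTransporters`, item S-VOC-1, p217365 — its listed
# sub-item «`blockAvg`∕`axial` ↦ `CovariantBlockAveraging` contours»)

Cell `pub-balaban`, SUBSTRATE cell, seat `b2b-balaban-substrate-p1`.  Summits-side under the LEAN PLACEMENT RULE (cell library).  HONEST
FRAMING: rung (B)+1 of the FINITE-VOLUME T⁴ programme — NOT infinite volume, NOT a mass gap, NOT Clay; spine PROVED 0∕9.  DICTIONARY ONLY:
definitions + algebraic identities; the adjoint identities of `Q_k(U)` (`Q Qᴴ`-type) and the path property of the contour system of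
record `CovariantBlockAveraging.contour` are item S-Q's (seat p3) and are NOT touched here; nothing of the audited papers is asserted.
HONEST DEPENDENCY (cell line, verbatim): continuum YM on T⁴ ⇐ BetaPertH ∧ nine spine estimates (0/9 proved); BetaPertH ⇐ (D1) ∧ (D4) ∧
CAP+tail; G-an2-4 gates asym, D1 and NE2/3/4.

WHAT.
* §1 `transport_transV`: `transport N (transV e ι U) μ Γ = ι (Π_{(x,ν) ∈ Γ} U(e⁻¹x, x + e_ν))` — V2's contour transport ([Balaban1985Averaging]
  (9) p. 18 «U(Γ) = Π U(x_i, x_{i+1})», shape) of the transporters of a V1 gauge field is the representation of the ordered product of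
  its bond variables (`map_list_prod`); `transport_transV_one`; norm one for unitary `ι`.
* §2 THE GAUGE LAW ALONG PATHS: `IsBondPath e Γ x y` (the bonds of `Γ` are consecutive from `x` to `y` in the V1 lattice, through the
  chart) and `transport_transV_gaugeAct`: along a bond path, `transport (transV e ι (U^u)) μ Γ = ι(u x) · transport (transV e ι U) μ Γ ·
  ι((u y)⁻¹)` (telescoping); for the empty path `x = y` and both sides are `1`.
* §3 **`QcovOf P ι h Γ U := Qcov (lev P.L k) (unitMod P) Γ (transV (siteIdx P h) ι U)`** — Bałaban's covariant `k`-fold block averaging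
  ([Balaban1985BackgroundPropagators] (3.14)–(3.15) p. 393, shape) of the V1 configuration `U` on level `j` (`j + k = K`) down to the
  unit lattice, along any contour system `Γ`, AS A FUNCTION OF `U`; `QcovOf_one : QcovOf P ι h Γ 1 = QvOp ⊗ 1` (NE2's free averaging
  lifted to colour, `CovariantBlockAveraging.Qcov_one` BY NAME); and the (3.24)-type operator WITHOUT the gauge term,
  `deltaQOf … c a Γ U := covLapOf (siteIdx P h) ι c U + a • (QcovOf …)ᴴ * QcovOf …` with `deltaQOf_one` (= `lapC + a·(Q_k ⊗ 1)ᴴ(Q_k ⊗ 1)`).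
Imports `SubstrateBackgroundTransporters` + `CovariantBlockAveraging`; nothing existing is modified.
-/

noncomputable section

open scoped BigOperators Matrix Kronecker Matrix.Norms.L2Operator

namespace Summit.QuantumFields.BalabanUV.T4Continuum.SubstrateCovariantAveraging

open Literature.MathematicalPhysics.QuantumFieldTheory.Balaban1983to89
open Literature.MathematicalPhysics.QuantumFieldTheory.Balaban1983to89.B5Prop11Plancherel (Tor unitVec shiftM fdiff fine)
open Literature.MathematicalPhysics.QuantumFieldTheory.Balaban1983to89.B5Block118 (QvOp)
open Literature.MathematicalPhysics.QuantumFieldTheory.Balaban1983to89.B5G183RateUnitTower (lev lev_neZero)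
open Summit.QuantumFields.BalabanUV.T4Continuum.BalabanAveragedTowerUnit (idx)
open Summit.QuantumFields.BalabanUV.T4Continuum.ColourCovariantLaplacian (covDc covLapC lapC)
open Summit.QuantumFields.BalabanUV.T4Continuum.CovariantBlockAveraging (transport transport_one ContourSystem Qcov Qcov_one)
open Summit.QuantumFields.BalabanUV.T4Continuum.SubstrateBackgroundTransporters

/-! ## §1 Contour transport of the transporters of a gauge field = `ι` of the ordered product of bond variables -/

section Transport

variable {P : Params} {j : ℕ} {N : Fin P.d → ℕ} (e : Site P j ≃ Tor N)
variable {G : Type*} [GaugeGroup G] {o : Type*} [Fintype o] [DecidableEq o] (ι : G →* Matrix o o ℂ)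

/-- [folklore] THE ORDERED PRODUCT OF BOND VARIABLES along a bond list `Γ` (first bond leftmost), read through the chart:
`Π_{(x,ν)∈Γ} U(e⁻¹x, e⁻¹x + e_ν)`. -/
def bondProd (Γ : List (Tor N × Fin P.d)) (U : GaugeField P j G) : G := (Γ.map fun b => U ⟨e.symm b.1, b.2⟩).prod

/-- [folklore] `bondProd` of the empty list is `1`. -/
@[simp] theorem bondProd_nil (U : GaugeField P j G) : bondProd e ([] : List (Tor N × Fin P.d)) U = 1 := rfl

/-- [folklore] `bondProd` of a cons. -/
theorem bondProd_cons (b : Tor N × Fin P.d) (Γ : List (Tor N × Fin P.d)) (U : GaugeField P j G) :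
    bondProd e (b :: Γ) U = U ⟨e.symm b.1, b.2⟩ * bondProd e Γ U := by
  simp [bondProd]

/-- [folklore] `bondProd` of a concatenation multiplies. -/
theorem bondProd_append (Γ Γ' : List (Tor N × Fin P.d)) (U : GaugeField P j G) :
    bondProd e (Γ ++ Γ') U = bondProd e Γ U * bondProd e Γ' U := by
  simp [bondProd, List.map_append, List.prod_append]

/-- [folklore] **V2's CONTOUR TRANSPORT OF THE TRANSPORTERS OF `U` IS `ι` OF THE ORDERED PRODUCT OF ITS BOND VARIABLES** (every colour
slot `μ`): `transport N (transV e ι U) μ Γ = ι (bondProd e Γ U)`. -/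
theorem transport_transV (U : GaugeField P j G) (μ : Fin P.d) (Γ : List (Tor N × Fin P.d)) :
    transport N (transV e ι U) μ Γ = ι (bondProd e Γ U) := by
  rw [transport, bondProd, map_list_prod, List.map_map]
  rfl

/-- [folklore] At `U = 1` every contour transport is `1` (also `CovariantBlockAveraging.transport_one`). -/
theorem transport_transV_one (μ : Fin P.d) (Γ : List (Tor N × Fin P.d)) :
    transport N (transV e ι (1 : GaugeField P j G)) μ Γ = 1 := by
  rw [transV_one, transport_one]

variable {ι} in
/-- [folklore] For unitary-valued `ι` every contour transport is unitary. -/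
theorem transport_transV_mem_unitaryGroup (hι : ∀ g, ι g ∈ Matrix.unitaryGroup o ℂ) (U : GaugeField P j G) (μ : Fin P.d)
    (Γ : List (Tor N × Fin P.d)) : transport N (transV e ι U) μ Γ ∈ Matrix.unitaryGroup o ℂ := by
  rw [transport_transV]
  exact hι _

variable {ι} in
/-- [folklore] … hence of operator norm one (`o` nonempty). -/
theorem norm_transport_transV [Nonempty o] (hι : ∀ g, ι g ∈ Matrix.unitaryGroup o ℂ) (U : GaugeField P j G) (μ : Fin P.d)
    (Γ : List (Tor N × Fin P.d)) : ‖transport N (transV e ι U) μ Γ‖ = 1 :=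
  UnitaryModel.norm_of_mem_unitaryGroup (transport_transV_mem_unitaryGroup e hι U μ Γ)

/-! ## §2 The gauge law along bond paths -/

/-- [folklore] `Γ` IS A BOND PATH FROM `x` TO `y` (V1 sites, read through the chart): the bonds are consecutive — each bond's source is
the current site and the next site is its target `· + e_ν`. -/
inductive IsBondPath (e : Site P j ≃ Tor N) : List (Tor N × Fin P.d) → Site P j → Site P j → Prop
  /-- the empty path stays put -/
  | nil (x : Site P j) : IsBondPath e [] x x
  /-- a bond sourced at `x` in direction `ν`, then a path from `x + e_ν` -/
  | cons {x y : Site P j} {ν : Fin P.d} {Γ : List (Tor N × Fin P.d)} (h : IsBondPath e Γ (x.shift ν) y) :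
      IsBondPath e ((e x, ν) :: Γ) x y

variable {e ι} in
/-- [folklore] **THE GAUGE LAW OF TRANSPORT ALONG A BOND PATH** (telescoping [Balaban1985Averaging] (8)–(9) p. 18, shape): along a bond
path from `x` to `y`, `ι(Π U^u) = ι(u x)·ι(Π U)·ι((u y)⁻¹)`. -/
theorem bondProd_gaugeAct {Γ : List (Tor N × Fin P.d)} {x y : Site P j} (hΓ : IsBondPath e Γ x y) (u : GaugeTransf P j G)
    (U : GaugeField P j G) : bondProd e Γ (GaugeField.gaugeAct u U) = u x * bondProd e Γ U * (u y)⁻¹ := by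
  induction hΓ with
  | nil x => rw [bondProd_nil, bondProd_nil, mul_one, mul_inv_cancel]
  | @cons x y ν Γ h ih =>
      rw [bondProd_cons, bondProd_cons, ih, Equiv.symm_apply_apply]
      simp only [GaugeField.gaugeAct, PBond.tgt]
      group

variable {e ι} in
/-- [folklore] The same law read in V2: along a bond path, `transport (transV e ι U^u) μ Γ = ι(u x)·transport (transV e ι U) μ Γ·ι((u y)⁻¹)`. -/
theorem transport_transV_gaugeAct {Γ : List (Tor N × Fin P.d)} {x y : Site P j} (hΓ : IsBondPath e Γ x y) (u : GaugeTransf P j G)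
    (U : GaugeField P j G) (μ : Fin P.d) :
    transport N (transV e ι (GaugeField.gaugeAct u U)) μ Γ = ι (u x) * transport N (transV e ι U) μ Γ * ι ((u y)⁻¹) := by
  rw [transport_transV, transport_transV, bondProd_gaugeAct hΓ, map_mul, map_mul]

variable {e} in
/-- [folklore] Bond paths concatenate. -/
theorem IsBondPath.append {Γ Γ' : List (Tor N × Fin P.d)} {x y z : Site P j} (h : IsBondPath e Γ x y) (h' : IsBondPath e Γ' y z) :
    IsBondPath e (Γ ++ Γ') x z := by
  induction h with
  | nil x => exact h'
  | cons h ih => exact IsBondPath.cons (ih h')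

variable {e} in
/-- [folklore] A single bond is a bond path from its source to its target. -/
theorem IsBondPath.single (x : Site P j) (ν : Fin P.d) : IsBondPath e [(e x, ν)] x (x.shift ν) :=
  IsBondPath.cons (IsBondPath.nil _)

end Transport

/-! ## §3 Bałaban's covariant block averaging OF A GAUGE FIELD, and the (3.24)-type operator without the gauge term -/

section Averaging

variable (P : Params) {G : Type*} [GaugeGroup G] {o : Type*} [Fintype o] [DecidableEq o] (ι : G →* Matrix o o ℂ)
variable {j k : ℕ} (h : j + k = P.K)

/-- [folklore] **`Q_k(U)` — THE COVARIANT `k`-FOLD BLOCK AVERAGING OF THE V1 CONFIGURATION `U`** on level `j` (`j + k = K`) down to the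
unit lattice, along the contour system `Γ` ([Balaban1985BackgroundPropagators] (3.14)–(3.15) shape; `CovariantBlockAveraging.Qcov` at
the transporters of `U` in the tower chart).  MAP §O1 O-3′ (of record v1): this is the ONE-STROKE MODEL of [Balaban1985BackgroundPropagators] (3.15)
p. 393 — one `k`-fold stroke whose contour legs carry `U`'s OWN fine-bond transports; print's `Q_j(U) = Q(Ū^{(j−1)}) ⋯ Q(Ū) Q(U)` («they are
compositions of j one-step averaging operators», ibid.) COMPOSES one-step averagings whose legs carry the averaged configurations' bond variables: a different linear operator at non-flat `U`, EQUAL to this one at `U = 1`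
(`QcovOf_one`) and gauge-covariant alike; the composite is a follower (`SubstrateCovariantAveragingComposite`, on demand). -/
def QcovOf (Γ : ContourSystem P.d (lev P.L k) (unitMod P)) (U : GaugeField P j G) :
    Matrix ((Tor (unitMod P) × Fin P.d) × o) ((Tor (fine (lev P.L k) (unitMod P)) × Fin P.d) × o) ℂ :=
  Qcov (lev P.L k) (unitMod P) Γ (transV (siteIdx P h) ι U)

/-- [folklore] `QcovOf` unfolded. -/
theorem QcovOf_eq (Γ : ContourSystem P.d (lev P.L k) (unitMod P)) (U : GaugeField P j G) :
    QcovOf P ι h Γ U = Qcov (lev P.L k) (unitMod P) Γ (transV (siteIdx P h) ι U) := rfl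

/-- [folklore] **AT `U = 1` THE COVARIANT AVERAGING OF THE DICTIONARY IS NE2's FREE AVERAGING LIFTED TO COLOUR, `Q_k ⊗ 1`**
(`CovariantBlockAveraging.Qcov_one` BY NAME, for every contour system). -/
theorem QcovOf_one (Γ : ContourSystem P.d (lev P.L k) (unitMod P)) :
    QcovOf P ι h Γ (1 : GaugeField P j G) = QvOp (lev P.L k) (unitMod P) ⊗ₖ (1 : Matrix o o ℂ) := by
  rw [QcovOf, transV_one, Qcov_one]

/-- [folklore] **THE (3.24)-TYPE OPERATOR WITHOUT THE GAUGE TERM**: `Δ_U + a·Q_k(U)ᴴQ_k(U)` on `ι`-valued vector fields of level `j`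
(lattice factor `c`, averaging weight `a`; the gauge term `D R(U) D*` of [Balaban1985BackgroundPropagators] (3.26) is NOT included —
it needs the scalar Green's function, item S-GREEN). -/
def deltaQOf (c : ℂ) (a : ℝ) (Γ : ContourSystem P.d (lev P.L k) (unitMod P)) (U : GaugeField P j G) :
    Matrix ((Tor (fine (lev P.L k) (unitMod P)) × Fin P.d) × o) ((Tor (fine (lev P.L k) (unitMod P)) × Fin P.d) × o) ℂ :=
  covLapOf (siteIdx P h) ι c U + (a : ℂ) • ((QcovOf P ι h Γ U)ᴴ * QcovOf P ι h Γ U)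

/-- [folklore] At `U = 1`: `deltaQOf … c a Γ 1 = (Δ ⊗ 1) + a·(Q_k ⊗ 1)ᴴ(Q_k ⊗ 1)` — the free operator lifted to colour (`covLapOf_one`,
`QcovOf_one`). -/
theorem deltaQOf_one (c : ℂ) (a : ℝ) (Γ : ContourSystem P.d (lev P.L k) (unitMod P)) :
    deltaQOf P ι h c a Γ (1 : GaugeField P j G) =
      lapC (fine (lev P.L k) (unitMod P)) c +
        (a : ℂ) • ((QvOp (lev P.L k) (unitMod P) ⊗ₖ (1 : Matrix o o ℂ))ᴴ * (QvOp (lev P.L k) (unitMod P) ⊗ₖ (1 : Matrix o o ℂ))) := by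
  rw [deltaQOf, covLapOf_one, QcovOf_one]

omit [DecidableEq o] in
/-- [folklore] NE2's covariant vector Laplacian `Σ_ν (∇^R_ν)ᴴ∇^R_ν` is self-adjoint for ANY transporter data (a sum of Gram matrices). -/
theorem covLapC_conjTranspose {N : Fin P.d → ℕ} [∀ μ, NeZero (N μ)] [DecidableEq o] (c : ℂ)
    (R : Fin P.d → (Tor N × Fin P.d → Matrix o o ℂ)) : (covLapC N c R)ᴴ = covLapC N c R := by
  unfold covLapC
  rw [Matrix.conjTranspose_sum]
  exact Finset.sum_congr rfl fun ν _ => by rw [Matrix.conjTranspose_mul, Matrix.conjTranspose_conjTranspose]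

/-- [folklore] `deltaQOf` is self-adjoint (a Gram sum plus a real multiple of a Gram matrix). -/
theorem deltaQOf_conjTranspose (c : ℂ) (a : ℝ) (Γ : ContourSystem P.d (lev P.L k) (unitMod P)) (U : GaugeField P j G) :
    (deltaQOf P ι h c a Γ U)ᴴ = deltaQOf P ι h c a Γ U := by
  have hQ : ((a : ℂ) • ((QcovOf P ι h Γ U)ᴴ * QcovOf P ι h Γ U))ᴴ = (a : ℂ) • ((QcovOf P ι h Γ U)ᴴ * QcovOf P ι h Γ U) := by
    rw [Matrix.conjTranspose_smul, Matrix.conjTranspose_mul, Matrix.conjTranspose_conjTranspose, Complex.star_def, Complex.conj_ofReal]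
  rw [deltaQOf, Matrix.conjTranspose_add, hQ, covLapOf, covLapC_conjTranspose]

end Averaging

end Summit.QuantumFields.BalabanUV.T4Continuum.SubstrateCovariantAveraging

end
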